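import Summits.PneNP.PneNP.Theses.SzkEntropy

/-!
# PneNP / SzkEntropy — the assembly `Assembly` (stmt-PneNP-10782)

Route `PneNP/SzkEntropy`, item stmt-PneNP-10782 (`Assembly`, rank 1):

  `PeaThreeNotInP → PeaMemPH → PhCollapse → CookModelBridge → PneNP`.

If `¬ PneNP` then every language of Cook's `NP` over `{0,1}` is in Cook's `P`; the model bridge
`CookModelBridge` transports this to `Nondeterministic.NP ⊆ Classes.P`, `PhCollapse` gives
`PH ⊆ P`, and monotonicity of the promise lift (`promiseLift_mono`) turns
`PEA_3 ∈ promiseLift PH` (`PeaMemPH` at `d = 3`) into `PEA_3 ∈ promiseLift P = PromiseP`,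
contradicting the thesis `PeaThreeNotInP`.

This is, verbatim, the type of the route's kernel-checked deciding theorem
`Summit.PneNP.PneNP.Theses.SzkEntropy.closes` (route file, rev 2, D-0027 §2.1), so the assembly
closes by `exact closes`.

References: Z. Dvir, D. Gutfreund, G. N. Rothblum, S. Vadhan, *On approximating the entropy of
polynomial mappings*, ICS 2011, Thm 1.1; S. Arora, B. Barak, *Computational Complexity: A Modern
Approach* (2009), Thm 5.4 (`P = NP ⇒ PH = P`).
-/

namespace Summit.PneNP.PneNP.Theorems

/-- **Assembly of route SzkEntropy** (item stmt-PneNP-10782):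
`PeaThreeNotInP → PeaMemPH → PhCollapse → CookModelBridge → PneNP`. If `P = NP` in Cook's model
then, through the model bridge, `NP ⊆ P` for the prelude classes, hence `PH ⊆ P` (`PhCollapse`),
hence `promiseLift PH ⊆ PromiseP ∋ PEA_3` (`PeaMemPH`, `promiseLift_mono`), contradicting
`PEA_3 ∉ PromiseP`. The statement is literally the type of the route's proved deciding theorem
`closes`. [DvirGutfreundRothblumVadhan2010, Thm 1.1; AroraBarakCC2009, Thm 5.4] -/
theorem szkEntropy_assembly_proof :
    Summit.PneNP.PneNP.Theses.SzkEntropy.Assembly := by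
  unfold Summit.PneNP.PneNP.Theses.SzkEntropy.Assembly
  exact Summit.PneNP.PneNP.Theses.SzkEntropy.closes

end Summit.PneNP.PneNP.Theorems
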